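import Summits.QuantumFields.BalabanUV.Beta.D1BFx.DressedVertexSplit
import Summits.QuantumFields.BalabanUV.Beta.SecondOrderRemainderTables

/-!
# `BalabanUV.Beta.D1BFx.DressedVertex2Split` — road «BF-x» for binder row D1, slot (K), PART 24 FILE 2 (H2), brick TT15 part 1∕2: **THE DRESSED BI-VERTEX SPLIT —
# the bm-dressed SECOND-ORDER chain-rule vertex of ANY packed kernel is the smooth-column bi-vertex minus the two gauge functions against the fine divergences of
# the two slots, plus the double correction** (the pair twin of leaf-01 g29's `DressedVertexSplit.vertexOfK_coDressKBmAt_eq_sub`; letter-free; the letter layer —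
# the OWNER's `Wmix`∕`Wgg` words — is part 2∕2 `D1BFx/ColumnGaugeSecondOrder`)

HONEST DEPENDENCY (cell records, verbatim): «continuum YM on T⁴ ⇐ BetaPertH ∧ nine spine estimates (0/9 proved); BetaPertH ⇐ (D1) ∧ (D4) ∧
CAP+tail; G-an2-4 gates asym, D1 and NE2/3/4.»  HONEST FRAMING (cell contract, verbatim): «discharging `BetaPertH` makes Bałaban's UV stability
UNCONDITIONAL — a real constructive-QFT result; it is NOT the continuum limit and NOT the Clay problem.»  THIS MODULE is [folklore] `tsum` bookkeeping BY NAME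
over an2's `SecondOrderResponse.vertex2OfK` ∕ `biLoc_vertexOfK_slice`, `OneStepKernelFamily.vertexOfK ∕ colH`, lit-balaban's `wsum` ∕ `LocStencil₂`, an2's `KernelWard.divV`,
`AxialDressingRooted.coDressKBmAt ∕ decays_coDressKBmAt`, leaf-01 g29's `DressedVertexSplit` (the fine summation by parts and the `ℓ¹` envelope of the block-mean gauge
function `abs_bmGaugeAt_weight_le`); `K`, `S₂` ARBITRARY (displayed: `K` decaying with block-enveloped columns at the two bonds, `LocStencil₂ S₂`).  No `def`, no `def … : Prop`,
nothing cited, NO printed hypothesis, 0 sorry.  0 root-level binders of row D1 discharged (hW ∕ hR-sockets ∕ hSX-socket ∕ D1Tel ∕ D1Rep = 0); (K) NOT closed; (J1) ONE OPEN ROW;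
NOT D1, NEVER «G-an2-4 closed», NOT `BetaPertH`, NOT continuum, NOT Clay.

ABSOLUTE RULE (cell charter, verbatim): «No internally-minted statement may enter as a cited fact. Every hypothesis is either kernel-proved in
this package or a verbatim quotation of a PUBLISHED theorem with page reference. The manuscript(s) under audit are NOT citable for their own
disputed steps — they are the thing under adjudication; programme-internal (2001/route/tribunal) claims are never citable.»

THE MATHEMATICS (dimension `d + 1`; `K′ := coDressKBmAt ρ N K`, `ρ = toSite r` an in-block root, `N ≥ 1`; `χ := bmGaugeAt ρ (colH K N μ y) N`, `χ′ := bmGaugeAt ρ (colH K N ν y′) N`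
the block-mean gauge functions of the two packing columns (gan24's `colH K′ = colH K − dχ`, `CoDressedColumnPairing.colH_coDressKBmAt_eq_sub_grad`); `A κ u := vertexOfK K N (S₂ κ u) ν y′`
the inner-vertex family of the bi-table, `B κ u := wsum χ′ (divV (S₂ κ u))` its inner gauge correction).
* §1 [folklore] analytic sockets: a slice of a `LocStencil₂` table is a `LocStencil` family (`locStencil_slice₂`); the inner-vertex family through a decaying kernel is a
  `LocStencil` family (`exists_locStencil_sliceVertex`); the block-mean gauge function of a block-enveloped column is absolutely summable (`summable_abs_bmGaugeAt`);
  entrywise bounds of `divV` and `wsum` of bounded families.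
* §2 [folklore] THE SPLIT: the inner split slot by slot (`vertexOfK_coDress_slice_eq_sub` = `DressedVertexSplit` on each slice), then ONE outer `DressedVertexSplit` on the dressed
  inner-vertex family: **`vertex2OfK K′ N S₂ μ y ν y′ = vertexOfK K N (A − B) μ y − wsum χ (divV (A − B))`** (`vertex2OfK_coDressKBmAt_eq_sub`), and — by linearity of
  `vertexOfK K N · μ y` and of `wsum χ ∘ divV` on bounded families with summable weights (`vertexOfK_sub_of_summable`, `vertexOfK_finset_sum_of_summable`, `wsum_sub_of_summable`,
  `wsum_finset_sum_of_summable`) — the FOUR-TERM form **`vertex2OfK K′ N S₂ μ y ν y′ = vertex2OfK K N S₂ μ y ν y′ − vertexOfK K N B μ y − wsum χ (divV A) + wsum χ (divV B)`**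
  (`vertex2OfK_coDressKBmAt_eq_four`): the bilinear expansion of the two dressed columns with each exact gradient summed by parts onto its own slot.
* §3 [folklore] the fine divergences of the two inner families, letter-free (the sockets the letter layer evaluates): `divV A w = vertexOfK K N (κ′ u′ ↦ divV (κ u ↦ S₂ κ u κ′ u′) w) ν y′`
  (`divV_sliceVertex_eq`), `divV B w = wsum χ′ (w′ ↦ divV (κ′ u′ ↦ divV (κ u ↦ S₂ κ u κ′ u′) w) w′)` (`divV_wsum_divV_slice_eq`, through the finite rearrangement `divV_divV_comm`).
Unit `b2b-balaban-beta-d1-formalise-leaf-01` (gen 31), D1 formalisation swarm LEAF PROVER 01, road «BF-x»; the OWNER d1-p2 g23's `PART24-HEAD-SPEC-g23.md` order #1 («the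
column-side second-order slot-shift letter»), moved to this lineage by first refusal on leaf-03 g30's INTENT-5 (journal).  Not in print; our bookkeeping.  No existing file touched.
-/

noncomputable section

namespace Summit.QuantumFields.BalabanUV.Beta.D1BFx.DressedVertex2Split

open Finset
open scoped BigOperators
open Literature.MathematicalPhysics.QuantumFieldTheory
open Literature.MathematicalPhysics.QuantumFieldTheory.LatticeForm (quo)
open Literature.MathematicalPhysics.QuantumFieldTheory.Balaban1983to89
open Literature.MathematicalPhysics.QuantumFieldTheory.Balaban1983to89.Beta
open B12Sec2to5 (l1 l1_nonneg)
open B4ContourShift (supNorm)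
open ExpKernelCalculus (MKer BiLoc Decays summable_exp_shift' Zl Zl_nonneg l1_sub_triangle l1_sub_symm)
open KernelWard (divV)
open B6BondElimination (unitVec)
open AffineAveraging (Site box toSite)
open OneStepResolventKernel (Fib wsum LocStencil decays_mono)
open OneStepKernelFamily (colH vertexOfK)
open BalabanCompositeJets (LocStencil₂)
open SecondOrderResponse (vertex2OfK biLoc_vertexOfK_slice)
open Summit.QuantumFields.BalabanUV.Beta.AxialDressingRooted (coDressKBmAt decays_coDressKBmAt)
open Summit.QuantumFields.BalabanUV.Beta.AxialProjectorBlockMean (bmGaugeAt)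
open Summit.QuantumFields.BalabanUV.Beta.WardLocusSecondOrder (abs_vertexOfK_le)
open Summit.QuantumFields.BalabanUV.Beta.SecondOrderSplitDecay (summable_colH_mul_bdd)
open Summit.QuantumFields.BalabanUV.Beta.SecondOrderRemainderTables (abs_le_of_locStencil₂)
open Summit.QuantumFields.BalabanUV.Beta.D1BFx.DressedVertexSplit (abs_bmGaugeAt_weight_le vertexOfK_coDressKBmAt_eq_sub)

variable {d : ℕ}

/-! ## §1 Analytic sockets -/

/-- [folklore] A SLICE `S₂ κ u` of a `LocStencil₂` table, read as a stencil family in its second bond, is a `LocStencil` family at half the rate (same constant):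
`|S₂ κ u κ′ u′ x z a b| ≤ C₂·e^{−δ|u′−u|}·e^{−δ(|x−u|+|z−u|)} ≤ C₂·e^{−(δ∕2)(|x−u′|+|z−u′|)}` (two triangle inequalities). -/
theorem locStencil_slice₂ {S₂ : Fin (d + 1) → Site (d + 1) → Fin (d + 1) → Site (d + 1) → MKer (d + 1) (Fib d)} {C₂ δ : ℝ}
    (hS₂ : LocStencil₂ S₂ C₂ δ) (hδ : 0 ≤ δ) (κ : Fin (d + 1)) (u : Site (d + 1)) : LocStencil (S₂ κ u) C₂ (δ / 2) := by
  have hC : 0 ≤ C₂ := hS₂.nonneg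
  intro κ' u' x z a b
  have h := hS₂ κ u κ' u' x z a b
  have tx : l1 (x - u') ≤ l1 (x - u) + l1 (u - u') := l1_sub_triangle x u u'
  have tz : l1 (z - u') ≤ l1 (z - u) + l1 (u - u') := l1_sub_triangle z u u'
  rw [l1_sub_symm u u'] at tx tz
  calc |S₂ κ u κ' u' x z a b| ≤ C₂ * Real.exp (-δ * l1 (u' - u)) * Real.exp (-δ * (l1 (x - u) + l1 (z - u))) := h
    _ = C₂ * Real.exp (-δ * l1 (u' - u) + -δ * (l1 (x - u) + l1 (z - u))) := by rw [mul_assoc, ← Real.exp_add]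
    _ ≤ C₂ * Real.exp (-(δ / 2) * (l1 (x - u') + l1 (z - u'))) := by
        refine mul_le_mul_of_nonneg_left (Real.exp_le_exp.2 ?_) hC
        nlinarith [l1_nonneg (x - u), l1_nonneg (z - u), l1_nonneg (u' - u)]

/-- [folklore] **THE INNER-VERTEX FAMILY OF A `LocStencil₂` TABLE THROUGH A DECAYING KERNEL IS A `LocStencil` FAMILY**: `κ u ↦ vertexOfK K N (S₂ κ u) ν y′` is bi-localised at
`(u, u)` with SOME constant and positive rate (an2's `biLoc_vertexOfK_slice` at the common rate `min δ_K δ₂`, far-centre factor dropped). -/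
theorem exists_locStencil_sliceVertex {N : ℕ} {K : MKer (d + 1) (Fib d)} (hK : ∃ δ C : ℝ, 0 < δ ∧ 0 ≤ C ∧ Decays K C δ)
    {S₂ : Fin (d + 1) → Site (d + 1) → Fin (d + 1) → Site (d + 1) → MKer (d + 1) (Fib d)} {C₂ δ₂ : ℝ} (hS₂ : LocStencil₂ S₂ C₂ δ₂) (hδ₂ : 0 < δ₂)
    (ν : Fin (d + 1)) (y' : Site (d + 1)) :
    ∃ CA δA : ℝ, 0 < δA ∧ LocStencil (fun κ u => vertexOfK K N (S₂ κ u) ν y') CA δA := by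
  obtain ⟨δK, C, hδK, hC, hKd⟩ := hK
  set m : ℝ := min δK δ₂ with hm
  have hmpos : 0 < m := lt_min hδK hδ₂
  have hKm : Decays K C m := decays_mono hKd hC le_rfl (min_le_left _ _)
  have hSm : LocStencil₂ S₂ C₂ m := hS₂.mono (min_le_right _ _)
  have hC₂ : 0 ≤ C₂ := hS₂.nonneg
  refine ⟨(d + 1 : ℕ) * (C * C₂ * Zl (d + 1) (m / 2)), m, hmpos, fun κ u x z a b => ?_⟩
  have h := biLoc_vertexOfK_slice (N := N) hKm hC hSm hmpos κ u ν y' x z a b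
  refine h.trans (mul_le_mul_of_nonneg_right ?_ (Real.exp_pos _).le)
  have hZ := Zl_nonneg (D := d + 1) (half_pos hmpos)
  have h0 : 0 ≤ (d + 1 : ℕ) * (C * C₂ * Zl (d + 1) (m / 2)) := by positivity
  have he : Real.exp (-(m / 2) * l1 (u - (N : ℤ) • y')) ≤ 1 := Real.exp_le_one_iff.2 (by nlinarith [l1_nonneg (u - (N : ℤ) • y')])
  calc ((d + 1 : ℕ) : ℝ) * (C * C₂ * Zl (d + 1) (m / 2) * Real.exp (-(m / 2) * l1 (u - (N : ℤ) • y')))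
      = (d + 1 : ℕ) * (C * C₂ * Zl (d + 1) (m / 2)) * Real.exp (-(m / 2) * l1 (u - (N : ℤ) • y')) := by ring
    _ ≤ (d + 1 : ℕ) * (C * C₂ * Zl (d + 1) (m / 2)) * 1 := mul_le_mul_of_nonneg_left he h0
    _ = _ := mul_one _

/-- [folklore] A weight with an `ℓ¹` decay envelope is absolutely summable. -/
theorem summable_abs_of_decay {χ : Site (d + 1) → ℝ} {C δ : ℝ} {p : Site (d + 1)} (hδ : 0 < δ) (hχ : ∀ u, |χ u| ≤ C * Real.exp (-δ * l1 (u - p))) :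
    Summable fun u => |χ u| :=
  Summable.of_nonneg_of_le (fun _ => abs_nonneg _) hχ ((summable_exp_shift' hδ p).mul_left C)

/-- [folklore] **THE BLOCK-MEAN GAUGE FUNCTION OF A BLOCK-ENVELOPED COLUMN IS ABSOLUTELY SUMMABLE** (leaf-01 g29's `abs_bmGaugeAt_weight_le` + the previous line). -/
theorem summable_abs_bmGaugeAt {N : ℕ} (hN : 1 ≤ N) {r : Fin (d + 1) → ℕ} (hr : r ∈ box (d + 1) N) (K : MKer (d + 1) (Fib d)) (μ : Fin (d + 1)) (y : Site (d + 1))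
    {M c : ℝ} (hM : 0 ≤ M) (hc : 0 < c) (hK : ∀ κ u, |colH K N μ y κ u| ≤ M * Real.exp (-(c * supNorm (quo N u - y)))) :
    Summable fun u => |bmGaugeAt (toSite r) (colH K N μ y) N u| := by
  have hN0 : (0 : ℝ) < N := by exact_mod_cast hN
  have hrate : 0 < c / (((d : ℝ) + 1) * N) := by positivity
  refine summable_abs_of_decay (C := (2 * (((d : ℝ) + 1) * N) * M) * Real.exp c) (p := (N : ℤ) • y) hrate fun u => ?_
  exact abs_bmGaugeAt_weight_le hN hr K μ y hM hc.le hK u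

/-- [folklore] The fine divergence of an entrywise bounded family is entrywise bounded: `|divV S w x z a b| ≤ (d+1)·(B + B)`. -/
theorem abs_divV_le {S : Fin (d + 1) → Site (d + 1) → MKer (d + 1) (Fib d)} {B : ℝ} (hS : ∀ κ u x z a b, |S κ u x z a b| ≤ B) (w x z : Site (d + 1)) (a b : Fib d) :
    |divV S w x z a b| ≤ (d + 1 : ℕ) * (B + B) := by
  simp only [KernelWard.divV, Finset.sum_apply, Pi.sub_apply]
  refine (Finset.abs_sum_le_sum_abs _ _).trans ?_
  refine (Finset.sum_le_sum fun κ _ => (abs_sub _ _).trans (add_le_add (hS κ _ x z a b) (hS κ _ x z a b))).trans ?_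
  rw [Finset.sum_const, Finset.card_univ, Fintype.card_fin, nsmul_eq_mul]

/-- [folklore] A weighted superposition of an entrywise bounded family with absolutely summable weights is entrywise bounded by `(Σ'|w|)·B`. -/
theorem abs_wsum_le_of_bdd {w : Site (d + 1) → ℝ} (hw : Summable fun u => |w u|) {S : Site (d + 1) → MKer (d + 1) (Fib d)} {B : ℝ}
    (hS : ∀ u x z a b, |S u x z a b| ≤ B) (x z : Site (d + 1)) (a b : Fib d) : |wsum w S x z a b| ≤ (∑' u, |w u|) * B := by
  unfold OneStepResolventKernel.wsum
  have hs : Summable fun u => |w u| * B := hw.mul_right B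
  have hle : ∀ u, ‖w u * S u x z a b‖ ≤ |w u| * B := fun u => by
    rw [Real.norm_eq_abs, abs_mul]; exact mul_le_mul_of_nonneg_left (hS u x z a b) (abs_nonneg _)
  have h := tsum_of_norm_bounded hs.hasSum hle
  rw [Real.norm_eq_abs] at h
  refine h.trans (le_of_eq ?_)
  rw [tsum_mul_right]

/-- [folklore] Summability of a weighted bounded family: `u ↦ w u · S u x z a b`. -/
theorem summable_wsum_of_bdd {w : Site (d + 1) → ℝ} (hw : Summable fun u => |w u|) {S : Site (d + 1) → MKer (d + 1) (Fib d)} {B : ℝ}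
    (hS : ∀ u x z a b, |S u x z a b| ≤ B) (x z : Site (d + 1)) (a b : Fib d) : Summable fun u => w u * S u x z a b :=
  Summable.of_norm_bounded (hw.mul_right B) (fun u => by
    rw [Real.norm_eq_abs, abs_mul]; exact mul_le_mul_of_nonneg_left (hS u x z a b) (abs_nonneg _))

/-! ## §2 The letter-free dressed bi-vertex split -/

section LetterFree

variable {N : ℕ} (hN : 1 ≤ N) {r : Fin (d + 1) → ℕ} (hr : r ∈ box (d + 1) N) {K : MKer (d + 1) (Fib d)} (hK : ∃ δ C : ℝ, 0 < δ ∧ 0 ≤ C ∧ Decays K C δ)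
  {S₂ : Fin (d + 1) → Site (d + 1) → Fin (d + 1) → Site (d + 1) → MKer (d + 1) (Fib d)} {C₂ δ₂ : ℝ} (hS₂ : LocStencil₂ S₂ C₂ δ₂) (hδ₂ : 0 < δ₂)
  (μ : Fin (d + 1)) (y : Site (d + 1)) (ν : Fin (d + 1)) (y' : Site (d + 1)) {M c : ℝ} (hM : 0 ≤ M) (hc : 0 < c)
  (hKμ : ∀ κ u, |colH K N μ y κ u| ≤ M * Real.exp (-(c * supNorm (quo N u - y))))
  (hKν : ∀ κ u, |colH K N ν y' κ u| ≤ M * Real.exp (-(c * supNorm (quo N u - y'))))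
include hN hr hS₂ hδ₂ hM hc

include hKν in
/-- [folklore] **THE INNER SPLIT, SLOT BY SLOT**: `vertexOfK K′ N (S₂ κ u) ν y′ = vertexOfK K N (S₂ κ u) ν y′ − wsum χ′ (divV (S₂ κ u))` (`DressedVertexSplit` on the slice). -/
theorem vertexOfK_coDress_slice_eq_sub (κ : Fin (d + 1)) (u : Site (d + 1)) :
    vertexOfK (coDressKBmAt (toSite r) N K) N (S₂ κ u) ν y'
      = vertexOfK K N (S₂ κ u) ν y' - wsum (bmGaugeAt (toSite r) (colH K N ν y') N) (divV (S₂ κ u)) :=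
  vertexOfK_coDressKBmAt_eq_sub hN hr K (locStencil_slice₂ hS₂ hδ₂.le κ u) (half_pos hδ₂) ν y' hM hc hKν

include hK hKμ hKν in
/-- [folklore] **THE DRESSED BI-VERTEX SPLIT (two-term form)**: with `A′ κ u := vertexOfK K N (S₂ κ u) ν y′ − wsum χ′ (divV (S₂ κ u))` (the split inner-vertex family),
`vertex2OfK K′ N S₂ μ y ν y′ = vertexOfK K N A′ μ y − wsum χ (divV A′)` — ONE outer `DressedVertexSplit` on the dressed inner-vertex family (a `LocStencil` family: §1 through the
decaying `K′`, an2's `decays_coDressKBmAt`), then the inner split inside. -/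
theorem vertex2OfK_coDressKBmAt_eq_sub :
    vertex2OfK (coDressKBmAt (toSite r) N K) N S₂ μ y ν y'
      = vertexOfK K N (fun κ u => vertexOfK K N (S₂ κ u) ν y' - wsum (bmGaugeAt (toSite r) (colH K N ν y') N) (divV (S₂ κ u))) μ y
        - wsum (bmGaugeAt (toSite r) (colH K N μ y) N)
            (divV fun κ u => vertexOfK K N (S₂ κ u) ν y' - wsum (bmGaugeAt (toSite r) (colH K N ν y') N) (divV (S₂ κ u))) := by
  obtain ⟨CA, δA, hδA, hA⟩ := exists_locStencil_sliceVertex (N := N) (decays_coDressKBmAt hN hr hK) hS₂ hδ₂ ν y'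
  have inner : (fun κ u => vertexOfK (coDressKBmAt (toSite r) N K) N (S₂ κ u) ν y')
      = fun κ u => vertexOfK K N (S₂ κ u) ν y' - wsum (bmGaugeAt (toSite r) (colH K N ν y') N) (divV (S₂ κ u)) :=
    funext fun κ => funext fun u => vertexOfK_coDress_slice_eq_sub hN hr hS₂ hδ₂ ν y' hM hc hKν κ u
  unfold vertex2OfK
  rw [vertexOfK_coDressKBmAt_eq_sub hN hr K hA hδA μ y hM hc hKμ, inner]

omit hN hr hS₂ hδ₂ hM hc in
/-- [folklore] The fine divergence is additive-group linear in the family: `divV (A − B) w = divV A w − divV B w`. -/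
theorem divV_sub (A B : Fin (d + 1) → Site (d + 1) → MKer (d + 1) (Fib d)) (w : Site (d + 1)) :
    divV (fun κ u => A κ u - B κ u) w = divV A w - divV B w := by
  simp only [KernelWard.divV, ← Finset.sum_sub_distrib]
  refine Finset.sum_congr rfl fun κ _ => ?_
  abel

omit hN hr hS₂ hδ₂ hM hc in
/-- [folklore] Subtractivity of the chain-rule vertex in the family slot, with the two entrywise summabilities as the only hypotheses. -/
theorem vertexOfK_sub_of_summable (K : MKer (d + 1) (Fib d)) {P Q : Fin (d + 1) → Site (d + 1) → MKer (d + 1) (Fib d)} (μ : Fin (d + 1)) (y : Site (d + 1))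
    (hP : ∀ (κ : Fin (d + 1)) (x z : Site (d + 1)) (a b : Fib d), Summable fun u => colH K N μ y κ u * P κ u x z a b)
    (hQ : ∀ (κ : Fin (d + 1)) (x z : Site (d + 1)) (a b : Fib d), Summable fun u => colH K N μ y κ u * Q κ u x z a b) :
    vertexOfK K N (fun κ u => P κ u - Q κ u) μ y = vertexOfK K N P μ y - vertexOfK K N Q μ y := by
  funext x z a b
  simp only [vertexOfK, OneStepResolventKernel.wsum, Pi.sub_apply, mul_sub]
  rw [← Finset.sum_sub_distrib]
  exact Finset.sum_congr rfl fun κ _ => (hP κ x z a b).tsum_sub (hQ κ x z a b)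

omit hN hr hS₂ hδ₂ hM hc in
/-- [folklore] The chain-rule vertex is additive over a finite family in the family slot (entrywise summabilities). -/
theorem vertexOfK_finset_sum_of_summable (K : MKer (d + 1) (Fib d)) {ι : Type*} (s : Finset ι) (P : ι → Fin (d + 1) → Site (d + 1) → MKer (d + 1) (Fib d))
    (μ : Fin (d + 1)) (y : Site (d + 1))
    (hP : ∀ i ∈ s, ∀ (κ : Fin (d + 1)) (x z : Site (d + 1)) (a b : Fib d), Summable fun u => colH K N μ y κ u * P i κ u x z a b) :
    vertexOfK K N (fun κ u => ∑ i ∈ s, P i κ u) μ y = ∑ i ∈ s, vertexOfK K N (P i) μ y := by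
  funext x z a b
  simp only [vertexOfK, OneStepResolventKernel.wsum, Finset.sum_apply, Finset.mul_sum]
  rw [Finset.sum_comm]
  exact Finset.sum_congr rfl fun κ _ => Summable.tsum_finsetSum fun i hi => hP i hi κ x z a b

omit hN hr hS₂ hδ₂ hM hc in
/-- [folklore] Subtractivity of the weighted superposition (entrywise summabilities). -/
theorem wsum_sub_of_summable (w : Site (d + 1) → ℝ) (S T : Site (d + 1) → MKer (d + 1) (Fib d))
    (hS : ∀ (x z : Site (d + 1)) (a b : Fib d), Summable fun u => w u * S u x z a b) (hT : ∀ (x z : Site (d + 1)) (a b : Fib d), Summable fun u => w u * T u x z a b) :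
    wsum w (fun u => S u - T u) = wsum w S - wsum w T := by
  funext x z a b
  simp only [OneStepResolventKernel.wsum, Pi.sub_apply, mul_sub]
  exact (hS x z a b).tsum_sub (hT x z a b)

omit hN hr hS₂ hδ₂ hM hc in
/-- [folklore] The weighted superposition is additive over a finite family (entrywise summabilities). -/
theorem wsum_finset_sum_of_summable {ι : Type*} (s : Finset ι) (w : Site (d + 1) → ℝ) (S : ι → Site (d + 1) → MKer (d + 1) (Fib d))
    (hS : ∀ i ∈ s, ∀ (x z : Site (d + 1)) (a b : Fib d), Summable fun u => w u * S i u x z a b) :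
    wsum w (fun u => ∑ i ∈ s, S i u) = ∑ i ∈ s, wsum w (S i) := by
  funext x z a b
  simp only [OneStepResolventKernel.wsum, Finset.sum_apply, Finset.mul_sum]
  exact Summable.tsum_finsetSum fun i hi => hS i hi x z a b

include hKν in
/-- [folklore] Entrywise bound of the gauge correction of a slice: `|wsum χ′ (divV (S₂ κ u)) x z a b| ≤ (Σ'|χ′|)·((d+1)·(C₂ + C₂))`. -/
theorem abs_wsum_divV_slice_le (κ : Fin (d + 1)) (u x z : Site (d + 1)) (a b : Fib d) :
    |wsum (bmGaugeAt (toSite r) (colH K N ν y') N) (divV (S₂ κ u)) x z a b|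
      ≤ (∑' w, |bmGaugeAt (toSite r) (colH K N ν y') N w|) * ((d + 1 : ℕ) * (C₂ + C₂)) :=
  abs_wsum_le_of_bdd (summable_abs_bmGaugeAt hN hr K ν y' hM hc hKν)
    (fun w x z a b => abs_divV_le (fun κ' u' x z a b => abs_le_of_locStencil₂ hS₂ hδ₂.le κ u κ' u' x z a b) w x z a b) x z a b

include hK hKμ hKν in
/-- [folklore] **THE DRESSED BI-VERTEX SPLIT (four-term form)**: with `A κ u := vertexOfK K N (S₂ κ u) ν y′`, `B κ u := wsum χ′ (divV (S₂ κ u))`,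
`vertex2OfK K′ N S₂ μ y ν y′ = vertex2OfK K N S₂ μ y ν y′ − vertexOfK K N B μ y − wsum χ (divV A) + wsum χ (divV B)` — the bilinear expansion of the two dressed columns
`colH K′ = colH K − dχ` (both slots) with each `dχ` summed by parts onto its slot (the two-term form + linearity of `vertexOfK K N · μ y` and of `wsum χ ∘ divV` on bounded families). -/
theorem vertex2OfK_coDressKBmAt_eq_four :
    vertex2OfK (coDressKBmAt (toSite r) N K) N S₂ μ y ν y'
      = vertex2OfK K N S₂ μ y ν y'
        - vertexOfK K N (fun κ u => wsum (bmGaugeAt (toSite r) (colH K N ν y') N) (divV (S₂ κ u))) μ y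
        - wsum (bmGaugeAt (toSite r) (colH K N μ y) N) (divV fun κ u => vertexOfK K N (S₂ κ u) ν y')
        + wsum (bmGaugeAt (toSite r) (colH K N μ y) N) (divV fun κ u => wsum (bmGaugeAt (toSite r) (colH K N ν y') N) (divV (S₂ κ u))) := by
  rw [vertex2OfK_coDressKBmAt_eq_sub hN hr hK hS₂ hδ₂ μ y ν y' hM hc hKμ hKν]
  -- entrywise bounds of `A` and `B`
  have hC₂ : 0 ≤ C₂ := hS₂.nonneg
  have bA : ∀ (κ : Fin (d + 1)) (u x z : Site (d + 1)) (a b : Fib d), |vertexOfK K N (S₂ κ u) ν y' x z a b| ≤ ∑ κ', (∑' u', |colH K N ν y' κ' u'|) * C₂ :=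
    fun κ u x z a b => abs_vertexOfK_le (N := N) hK (fun κ' u' x z a b => abs_le_of_locStencil₂ hS₂ hδ₂.le κ u κ' u' x z a b) ν y' x z a b
  have bB := abs_wsum_divV_slice_le hN hr hS₂ hδ₂ ν y' hM hc hKν
  -- linearity of the undressed outer vertex
  have e1 : vertexOfK K N (fun κ u => vertexOfK K N (S₂ κ u) ν y' - wsum (bmGaugeAt (toSite r) (colH K N ν y') N) (divV (S₂ κ u))) μ y
      = vertexOfK K N (fun κ u => vertexOfK K N (S₂ κ u) ν y') μ y
        - vertexOfK K N (fun κ u => wsum (bmGaugeAt (toSite r) (colH K N ν y') N) (divV (S₂ κ u))) μ y :=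
    vertexOfK_sub_of_summable K μ y (fun κ x z a b => summable_colH_mul_bdd (N := N) hK (fun u => bA κ u x z a b) μ y κ)
      (fun κ x z a b => summable_colH_mul_bdd (N := N) hK (fun u => bB κ u x z a b) μ y κ)
  -- linearity of `wsum χ ∘ divV`
  have hχ := summable_abs_bmGaugeAt hN hr K μ y hM hc hKμ
  have e2 : wsum (bmGaugeAt (toSite r) (colH K N μ y) N)
        (divV fun κ u => vertexOfK K N (S₂ κ u) ν y' - wsum (bmGaugeAt (toSite r) (colH K N ν y') N) (divV (S₂ κ u)))
      = wsum (bmGaugeAt (toSite r) (colH K N μ y) N) (divV fun κ u => vertexOfK K N (S₂ κ u) ν y')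
        - wsum (bmGaugeAt (toSite r) (colH K N μ y) N) (divV fun κ u => wsum (bmGaugeAt (toSite r) (colH K N ν y') N) (divV (S₂ κ u))) := by
    have ed : (divV fun κ u => vertexOfK K N (S₂ κ u) ν y' - wsum (bmGaugeAt (toSite r) (colH K N ν y') N) (divV (S₂ κ u)))
        = fun w => divV (fun κ u => vertexOfK K N (S₂ κ u) ν y') w - divV (fun κ u => wsum (bmGaugeAt (toSite r) (colH K N ν y') N) (divV (S₂ κ u))) w :=
      funext fun w => divV_sub _ _ w
    rw [ed]
    exact wsum_sub_of_summable _ _ _ (fun x z a b => summable_wsum_of_bdd hχ (fun w x z a b => abs_divV_le bA w x z a b) x z a b)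
      (fun x z a b => summable_wsum_of_bdd hχ (fun w x z a b => abs_divV_le bB w x z a b) x z a b)
  rw [e1, e2]
  unfold vertex2OfK
  abel

end LetterFree

/-! ## §3 The fine divergences of the two inner families (letter-free sockets of the letter layer) -/

/-- [folklore] **THE TWO FINE DIVERGENCES OF A BI-TABLE COMMUTE**: `divV (κ u ↦ divV (S₂ κ u) w′) w = divV (κ′ u′ ↦ divV (κ u ↦ S₂ κ u κ′ u′) w) w′` (a finite rearrangement). -/
theorem divV_divV_comm (S₂ : Fin (d + 1) → Site (d + 1) → Fin (d + 1) → Site (d + 1) → MKer (d + 1) (Fib d)) (w w' : Site (d + 1)) :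
    divV (fun κ u => divV (S₂ κ u) w') w = divV (fun κ' u' => divV (fun κ u => S₂ κ u κ' u') w) w' := by
  simp only [KernelWard.divV, ← Finset.sum_sub_distrib]
  rw [Finset.sum_comm]
  exact Finset.sum_congr rfl fun κ' _ => Finset.sum_congr rfl fun κ _ => by abel

section Divergences

variable {N : ℕ} {K : MKer (d + 1) (Fib d)} {S₂ : Fin (d + 1) → Site (d + 1) → Fin (d + 1) → Site (d + 1) → MKer (d + 1) (Fib d)}

/-- [folklore] **THE FINE DIVERGENCE OF THE INNER-VERTEX FAMILY IS THE INNER VERTEX OF THE FIRST-SLOT DIVERGENCES** (no letters; decaying `K`, entrywise bounded `S₂`):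
`divV (κ u ↦ vertexOfK K N (S₂ κ u) ν y′) w = vertexOfK K N (κ′ u′ ↦ divV (κ u ↦ S₂ κ u κ′ u′) w) ν y′`. -/
theorem divV_sliceVertex_eq (hK : ∃ δ C : ℝ, 0 < δ ∧ 0 ≤ C ∧ Decays K C δ) {B₂ : ℝ} (hB : ∀ κ u κ' u' x z a b, |S₂ κ u κ' u' x z a b| ≤ B₂)
    (ν : Fin (d + 1)) (y' : Site (d + 1)) (w : Site (d + 1)) :
    divV (fun κ u => vertexOfK K N (S₂ κ u) ν y') w = vertexOfK K N (fun κ' u' => divV (fun κ u => S₂ κ u κ' u') w) ν y' := by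
  have hs : ∀ (κ : Fin (d + 1)) (u : Site (d + 1)) (κ' : Fin (d + 1)) (x z : Site (d + 1)) (a b : Fib d),
      Summable fun u' => colH K N ν y' κ' u' * S₂ κ u κ' u' x z a b :=
    fun κ u κ' x z a b => summable_colH_mul_bdd (N := N) hK (fun u' => hB κ u κ' u' x z a b) ν y' κ'
  calc divV (fun κ u => vertexOfK K N (S₂ κ u) ν y') w
      = ∑ κ : Fin (d + 1), (vertexOfK K N (S₂ κ (w - unitVec κ)) ν y' - vertexOfK K N (S₂ κ w) ν y') := by simp only [KernelWard.divV]
    _ = ∑ κ : Fin (d + 1), vertexOfK K N (fun κ' u' => S₂ κ (w - unitVec κ) κ' u' - S₂ κ w κ' u') ν y' :=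
        Finset.sum_congr rfl fun κ _ =>
          (vertexOfK_sub_of_summable K ν y' (fun κ' x z a b => hs κ _ κ' x z a b) (fun κ' x z a b => hs κ w κ' x z a b)).symm
    _ = vertexOfK K N (fun κ' u' => ∑ κ : Fin (d + 1), (S₂ κ (w - unitVec κ) κ' u' - S₂ κ w κ' u')) ν y' :=
        (vertexOfK_finset_sum_of_summable K Finset.univ (fun κ κ' u' => S₂ κ (w - unitVec κ) κ' u' - S₂ κ w κ' u') ν y'
          (fun κ _ κ' x z a b => by simpa only [Pi.sub_apply, mul_sub] using (hs κ _ κ' x z a b).sub (hs κ w κ' x z a b))).symm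
    _ = vertexOfK K N (fun κ' u' => divV (fun κ u => S₂ κ u κ' u') w) ν y' := by simp only [KernelWard.divV]

/-- [folklore] **THE FINE DIVERGENCE OF THE GAUGE-CORRECTION FAMILY** (no letters; absolutely summable `χ′`, entrywise bounded `S₂`):
`divV (κ u ↦ wsum χ′ (divV (S₂ κ u))) w = wsum χ′ (w′ ↦ divV (κ′ u′ ↦ divV (κ u ↦ S₂ κ u κ′ u′) w) w′)` (linearity of `wsum χ′` on bounded families + `divV_divV_comm`). -/
theorem divV_wsum_divV_slice_eq {χ' : Site (d + 1) → ℝ} (hχ' : Summable fun u => |χ' u|) {B₂ : ℝ} (hB : ∀ κ u κ' u' x z a b, |S₂ κ u κ' u' x z a b| ≤ B₂)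
    (w : Site (d + 1)) :
    divV (fun κ u => wsum χ' (divV (S₂ κ u))) w = wsum χ' (fun w' => divV (fun κ' u' => divV (fun κ u => S₂ κ u κ' u') w) w') := by
  have eb : ∀ κ u w' x z a b, |divV (S₂ κ u) w' x z a b| ≤ (d + 1 : ℕ) * (B₂ + B₂) :=
    fun κ u w' x z a b => abs_divV_le (fun κ' u' x z a b => hB κ u κ' u' x z a b) w' x z a b
  have hs : ∀ (κ : Fin (d + 1)) (u : Site (d + 1)) (x z : Site (d + 1)) (a b : Fib d), Summable fun w' => χ' w' * divV (S₂ κ u) w' x z a b :=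
    fun κ u x z a b => summable_wsum_of_bdd hχ' (fun w' x z a b => eb κ u w' x z a b) x z a b
  have ec : (fun w' => divV (fun κ' u' => divV (fun κ u => S₂ κ u κ' u') w) w') = fun w' => divV (fun κ u => divV (S₂ κ u) w') w :=
    funext fun w' => (divV_divV_comm S₂ w w').symm
  rw [ec]
  calc divV (fun κ u => wsum χ' (divV (S₂ κ u))) w
      = ∑ κ : Fin (d + 1), (wsum χ' (divV (S₂ κ (w - unitVec κ))) - wsum χ' (divV (S₂ κ w))) := by simp only [KernelWard.divV]
    _ = ∑ κ : Fin (d + 1), wsum χ' (fun w' => divV (S₂ κ (w - unitVec κ)) w' - divV (S₂ κ w) w') :=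
        Finset.sum_congr rfl fun κ _ => (wsum_sub_of_summable χ' _ _ (hs κ _) (hs κ w)).symm
    _ = wsum χ' (fun w' => ∑ κ : Fin (d + 1), (divV (S₂ κ (w - unitVec κ)) w' - divV (S₂ κ w) w')) :=
        (wsum_finset_sum_of_summable Finset.univ χ' (fun κ w' => divV (S₂ κ (w - unitVec κ)) w' - divV (S₂ κ w) w')
          (fun κ _ x z a b => by simpa only [Pi.sub_apply, mul_sub] using (hs κ _ x z a b).sub (hs κ w x z a b))).symm
    _ = wsum χ' (fun w' => divV (fun κ u => divV (S₂ κ u) w') w) := by simp only [KernelWard.divV]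

end Divergences

end Summit.QuantumFields.BalabanUV.Beta.D1BFx.DressedVertex2Split

end
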